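import Summits.MatrixMultiplication.OmegaCensus.ThreeSetUniformZ4Z4
import Summits.MatrixMultiplication.OmegaCensus.DihedralLikeModel
import HarnessLib

/-!
# The uniform `ℤ₄²` theorem in the model `G(A, c₀)`: TPP capacity strictly below the mod-one law

ω-census `pub-omega`, family (b3), seat pub-omega-group gen 18.  Framing: lottery ticket; floor = certified bounds/negative
ranges.  VALUE: the census-facing form of `no_mod_one_law_of_onto_z4z4_uniform` (`ThreeSetUniformZ4Z4.lean`) for the concrete
groups `DihedralLikeGroup A c₀` (`c₀ + c₀ = 0`; `c₀ = 0`: generalised dihedral `Dih(A)`; `c₀ ≠ 0`: generalised dicyclic);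
NOT progress on ω.

* `dihedralLikeGroup_no_mod_one_law_of_onto_z4z4`: for every finite abelian `A ↠ ℤ₄ × ℤ₄` and every `c₀` with `2c₀ = 0`, no
  TPP triple of `G(A, c₀)` attains `3|S||T||U| + 8 = 8|A|`.
* `dihedralLikeGroup_volume_lt_of_onto_z4z4`: if moreover `|A| ≡ 1 (mod 3)`, every TPP triple has
  `|S||T||U| < 4·⌊2|A|/3⌋ = (8|A| − 8)/3` — the general dihedral-like ceiling (`DihedralLikeGroup.tpp_volume_le_law`) is never
  reached, so the TPP capacity of these groups is at most `(8|A| − 11)/3`.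
* `zm_zn_model_no_dicyclic_law`: the dicyclic law `3V + 16 = 8|A|` for `G(ℤ_m × ℤ_n, c₀)`, `mn` a power of two, `4 ∣ m, n`,
  `c₀ ↦ 0` in `ℤ₄²` — every order (instance `z16_z128_dicyclic_no_law_8_0`, order `4096`).
-/

namespace Summit.MatrixMultiplication.OmegaCensus

open Finset Literature.Combinatorics.Additive

section Model

variable {A : Type} [AddCommGroup A] [Fintype A] [DecidableEq A] {c₀ : A} [Fact (c₀ + c₀ = 0)]

/-- **Model form.**  `A ↠ ℤ₄ × ℤ₄`, `2c₀ = 0`: no TPP triple of `G(A, c₀)` attains `3|S||T||U| + 8 = 8|A|`. [folklore] -/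
theorem dihedralLikeGroup_no_mod_one_law_of_onto_z4z4 (φ : A →+ ZMod 4 × ZMod 4) (hφ : Function.Surjective φ)
    {S T U : Finset (DihedralLikeGroup A c₀)} (h : TripleProductProperty S T U) :
    3 * (S.card * T.card * U.card) + 8 ≠ 8 * Fintype.card A :=
  no_mod_one_law_of_onto_z4z4_uniform (ρ := (DihedralLikeGroup.rho : A → DihedralLikeGroup A c₀))
    (τ := DihedralLikeGroup.tau) (c₀ := c₀) DihedralLikeGroup.rho_mul_rho DihedralLikeGroup.rho_mul_tau
    DihedralLikeGroup.tau_mul_rho DihedralLikeGroup.tau_mul_tau DihedralLikeGroup.rho_injective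
    DihedralLikeGroup.tau_injective DihedralLikeGroup.rho_ne_tau DihedralLikeGroup.rho_or_tau φ hφ h

/-- **Capacity strictly below the ceiling.**  `A ↠ ℤ₄ × ℤ₄`, `|A| ≡ 1 (mod 3)`, `2c₀ = 0`: every TPP triple of `G(A, c₀)`
has `|S||T||U| < 4·⌊2|A|/3⌋` (`= (8|A| − 8)/3`). [folklore] -/
theorem dihedralLikeGroup_volume_lt_of_onto_z4z4 (φ : A →+ ZMod 4 × ZMod 4) (hφ : Function.Surjective φ)
    (hmod : Fintype.card A % 3 = 1) {S T U : Finset (DihedralLikeGroup A c₀)} (h : TripleProductProperty S T U) :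
    S.card * T.card * U.card < 4 * (2 * Fintype.card A / 3) := by
  have h16 : 16 ∣ Fintype.card A := sixteen_dvd_card_of_onto_z4z4 φ hφ
  have hpos : 0 < Fintype.card A := Fintype.card_pos
  have hle := DihedralLikeGroup.tpp_volume_le_law (c₀ := c₀) (by obtain ⟨k, hk⟩ := h16; omega) h
  have hne := dihedralLikeGroup_no_mod_one_law_of_onto_z4z4 (c₀ := c₀) φ hφ h
  set V := S.card * T.card * U.card with hV
  omega

end Model

/-! ## Named families in the model -/

section Named

/-- **`Dih(ℤ₄ × ℤ₄ × ℤ_n)` and its dicyclic twins, every `n`**: for `G(ℤ₄ × ℤ₄ × ℤ_n, c₀)` (`2c₀ = 0`) no TPP triple attains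
`3|S||T||U| + 8 = 8·16n`. [folklore] -/
theorem z4_z4_zn_model_no_mod_one_law (n : ℕ) [NeZero n] (c₀ : ZMod 4 × (ZMod 4 × ZMod n)) [Fact (c₀ + c₀ = 0)]
    {S T U : Finset (DihedralLikeGroup (ZMod 4 × (ZMod 4 × ZMod n)) c₀)} (h : TripleProductProperty S T U) :
    3 * (S.card * T.card * U.card) + 8 ≠ 8 * Fintype.card (ZMod 4 × (ZMod 4 × ZMod n)) :=
  dihedralLikeGroup_no_mod_one_law_of_onto_z4z4 _ (z4_z4_zn_onto_z4z4 n) h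

/-- **`G(ℤ_m × ℤ_n, c₀)` with `4 ∣ m`, `4 ∣ n`** (`2c₀ = 0`): no TPP triple attains `3|S||T||U| + 8 = 8mn`. [folklore] -/
theorem zm_zn_model_no_mod_one_law {m n : ℕ} [NeZero m] [NeZero n] (hm : 4 ∣ m) (hn : 4 ∣ n) (c₀ : ZMod m × ZMod n)
    [Fact (c₀ + c₀ = 0)] {S T U : Finset (DihedralLikeGroup (ZMod m × ZMod n) c₀)} (h : TripleProductProperty S T U) :
    3 * (S.card * T.card * U.card) + 8 ≠ 8 * Fintype.card (ZMod m × ZMod n) :=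
  dihedralLikeGroup_no_mod_one_law_of_onto_z4z4 _ (zm_zn_onto_z4z4 hm hn) h

/-- **Dicyclic twins over rank-two `2`-groups: `G(ℤ_m × ℤ_n, c₀)` with `m n ∣ 2^k`, `4 ∣ m`, `4 ∣ n`, `c₀ ≠ 0`, `2c₀ = 0` and
`c₀ ≡ 0` under the reduction to `ℤ₄ × ℤ₄`** (e.g. `c₀ = (m/2, 0)` with `8 ∣ m`): no TPP triple attains the dicyclic law
`3|S||T||U| + 16 = 8mn` — all orders at once (gen 16's five instances at `mn = 512` were the previous frontier). [folklore] -/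
theorem zm_zn_model_no_dicyclic_law {m n k : ℕ} [NeZero m] [NeZero n] (hm : 4 ∣ m) (hn : 4 ∣ n) (hk : m * n ∣ 2 ^ k)
    (c₀ : ZMod m × ZMod n) [Fact (c₀ + c₀ = 0)] (hc₀ : c₀ ≠ 0)
    (hΦc : ((ZMod.castHom hm (ZMod 4)).toAddMonoidHom.prodMap (ZMod.castHom hn (ZMod 4)).toAddMonoidHom) c₀ = 0)
    {S T U : Finset (DihedralLikeGroup (ZMod m × ZMod n) c₀)} (h : TripleProductProperty S T U) :
    3 * (S.card * T.card * U.card) + 16 ≠ 8 * Fintype.card (ZMod m × ZMod n) := by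
  obtain ⟨t, ht⟩ := hk
  have hA2 : ∀ a : ZMod m × ZMod n, (2 ^ k) • a = 0 := fun a => by
    rw [ht, mul_nsmul, show m * n = Fintype.card (ZMod m × ZMod n) by simp, card_nsmul_eq_zero, nsmul_zero]
  exact no_dicyclic_law_two_group_of_onto_z4z4 (ρ := (DihedralLikeGroup.rho : _ → DihedralLikeGroup (ZMod m × ZMod n) c₀))
    (τ := DihedralLikeGroup.tau) DihedralLikeGroup.rho_mul_rho DihedralLikeGroup.rho_mul_tau DihedralLikeGroup.tau_mul_rho
    DihedralLikeGroup.tau_mul_tau hc₀ DihedralLikeGroup.rho_injective DihedralLikeGroup.tau_injective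
    DihedralLikeGroup.rho_ne_tau DihedralLikeGroup.rho_or_tau hA2 _ (zm_zn_onto_z4z4 hm hn) hΦc h

/-- Example: **`G(ℤ₈ × ℤ_{2^j·4}, (4, 0))`-type instance `G(ℤ₁₆ × ℤ₁₂₈, (8,0))` (order `4096`, `A/⟨c₀⟩ ≅ ℤ₈ × ℤ₁₂₈`)**: the
dicyclic law is not attained (an order beyond every earlier table). [folklore] -/
theorem z16_z128_dicyclic_no_law_8_0 [Fact (((8, 0) : ZMod 16 × ZMod 128) + (8, 0) = 0)]
    {S T U : Finset (DihedralLikeGroup (ZMod 16 × ZMod 128) (8, 0))} (h : TripleProductProperty S T U) :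
    3 * (S.card * T.card * U.card) + 16 ≠ 8 * Fintype.card (ZMod 16 × ZMod 128) :=
  zm_zn_model_no_dicyclic_law (k := 11) (by norm_num) (by norm_num) (by norm_num) (8, 0) (by decide) (by decide) h

end Named

end Summit.MatrixMultiplication.OmegaCensus
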